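import Literature.MathematicalPhysics.QuantumLattice.RepKillingFormBridge
import Mathlib.Analysis.InnerProductSpace.Trace
import Mathlib.Analysis.InnerProductSpace.PiL2
import Mathlib.Algebra.Order.BigOperators.Ring.Finset
import HarnessLib

/-!
# Bounds for the Killing form of `𝔤_r`: `0 ≤ −K(X,X) ≤ 4·dim 𝔤_r·⟨X,X⟩_HS`; the Casimir ratio is a genuine supremum,
# and `λ(G, r) > 0 ⇔ 𝔤_r` is non-abelian — for EVERY unitary representation of a compact group

Topic `Literature/MathematicalPhysics/QuantumLattice`; completes the `casimirRatio` API of `RepKillingForm.lean` /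
`RepKillingFormBridge.lean` beyond the compact SIMPLE case (where the ratio is attained exactly):

* `hsForm_mul_self_le` — submultiplicativity of the Hilbert–Schmidt form, `⟨XY, XY⟩ ≤ ⟨X,X⟩⟨Y,Y⟩` (Cauchy–Schwarz entrywise);
  `hsForm_bracket_self_le` — `⟨[X,B],[X,B]⟩ ≤ 4⟨X,X⟩⟨B,B⟩`;
* `hsForm_repAd_left` — `ad X` is skew for the Hilbert–Schmidt form on `𝔤_r ≤ 𝔲(N)` (Hall, Prop. 7.4 (7.1));
* **`neg_repKilling_self_le`** — `−K_r(X,X) = ∑ₐ ‖[X, eₐ]‖² ≤ 4·dim_ℝ 𝔤_r·⟨X,X⟩_HS` in an HS-orthonormal basis `(eₐ)` of `𝔤_r`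
  (the trace formula `Tr T = ∑ ⟨eₐ, T eₐ⟩`, Mathlib `LinearMap.trace_eq_sum_inner`, for the inner-product structure on `𝔤_r` given
  by the Hilbert–Schmidt form);
* hence `casimirRatioSet_subset_Icc`, `bddAbove_casimirRatioSet`, **`casimirRatio_le`** (`λ(G,r) ≤ 4 dim 𝔤_r`),
  `div_le_casimirRatio` (every Rayleigh quotient is `≤ λ`), and the structural dichotomy
  **`casimirRatio_pos_iff`**: `0 < λ(G, r) ⇔ ∃ X Y ∈ 𝔤_r, XY ≠ YX` / `casimirRatio_eq_zero_iff`: `λ(G,r) = 0 ⇔ 𝔤_r` abelian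
  (e.g. `G = U(1)`: `b₀(G,r) = 11λ/(48π²) = 0`, no asymptotic freedom — consistent bookkeeping for `AsymptoticFreedomScale.lean`).

No instance is declared: the inner-product-space structure on `𝔤_r` is built inside the proof from `InnerProductSpace.Core`
(as in `Literature.Algebra.Lie.CompactKillingForm`).  **Sources.** B. C. Hall, GTM 222 (2015) [Hall2015], Prop. 7.4 and Exercise 7.6
(the orthonormal-basis computation `κ(x,x) = −∑‖[x,eₐ]‖²`); T. Bröcker, T. tom Dieck, GTM 98 (1985) [BrockerTomDieck1985], V (5.13).
-/

noncomputable section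

open Module Matrix
open scoped InnerProductSpace

namespace Literature.MathematicalPhysics.QuantumLattice

open Literature.MathematicalPhysics.QuantumFieldTheory (LatticeRep)

/-! ### §1 Hilbert–Schmidt inequalities on `M_n(ℂ)` -/

section HS

variable {n : Type*} [Fintype n]

/-- **Submultiplicativity of the Hilbert–Schmidt form**: `⟨XY, XY⟩_HS ≤ ⟨X,X⟩_HS·⟨Y,Y⟩_HS` (Cauchy–Schwarz on each entry
`(XY)_{ji} = ∑ₖ X_{jk}Y_{ki}`). [cite: Hall2015, Exercise 7.3] -/
theorem hsForm_mul_self_le (X Y : Matrix n n ℂ) : hsForm (X * Y) (X * Y) ≤ hsForm X X * hsForm Y Y := by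
  classical
  rw [hsForm_self_eq_sum, hsForm_self_eq_sum, hsForm_self_eq_sum]
  -- entrywise Cauchy–Schwarz
  have hentry : ∀ i j, Complex.normSq ((X * Y) j i) ≤
      (∑ k, Complex.normSq (X j k)) * ∑ k, Complex.normSq (Y k i) := by
    intro i j
    rw [Matrix.mul_apply, Complex.normSq_eq_norm_sq]
    have h1 : ‖∑ k, X j k * Y k i‖ ≤ ∑ k, ‖X j k‖ * ‖Y k i‖ :=
      (norm_sum_le _ _).trans (Finset.sum_le_sum fun k _ => (norm_mul_le _ _))
    have h2 : (∑ k, ‖X j k‖ * ‖Y k i‖) ^ 2 ≤ (∑ k, ‖X j k‖ ^ 2) * ∑ k, ‖Y k i‖ ^ 2 :=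
      Finset.sum_mul_sq_le_sq_mul_sq _ _ _
    simp_rw [Complex.normSq_eq_norm_sq]
    calc ‖∑ k, X j k * Y k i‖ ^ 2 ≤ (∑ k, ‖X j k‖ * ‖Y k i‖) ^ 2 :=
          pow_le_pow_left₀ (norm_nonneg _) h1 2
      _ ≤ _ := h2
  -- sum over the entries and refactor
  calc ∑ i, ∑ j, Complex.normSq ((X * Y) j i)
      ≤ ∑ i, ∑ j, (∑ k, Complex.normSq (X j k)) * ∑ k, Complex.normSq (Y k i) :=
        Finset.sum_le_sum fun i _ => Finset.sum_le_sum fun j _ => hentry i j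
    _ = (∑ j, ∑ k, Complex.normSq (X j k)) * ∑ i, ∑ k, Complex.normSq (Y k i) := by
        rw [Finset.sum_mul_sum]
        rw [Finset.sum_comm]
    _ = (∑ i, ∑ j, Complex.normSq (X j i)) * ∑ i, ∑ j, Complex.normSq (Y j i) := by
        rw [Finset.sum_comm (f := fun j k => Complex.normSq (X j k))]

/-- `⟨A − C, A − C⟩_HS ≤ 2⟨A,A⟩_HS + 2⟨C,C⟩_HS` (parallelogram). [cite: Hall2015, Exercise 7.3] -/
theorem hsForm_sub_self_le (A C : Matrix n n ℂ) : hsForm (A - C) (A - C) ≤ 2 * hsForm A A + 2 * hsForm C C := by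
  have hsum : hsForm (A - C) (A - C) + hsForm (A + C) (A + C) = 2 * hsForm A A + 2 * hsForm C C := by
    simp only [sub_eq_add_neg, hsForm_add_left, hsForm_add_right, ← neg_one_smul ℝ C, hsForm_smul_left,
      hsForm_smul_right, hsForm_comm C A]
    ring
  linarith [hsForm_self_nonneg (A + C)]

/-- **`⟨XB − BX, XB − BX⟩_HS ≤ 4⟨X,X⟩_HS⟨B,B⟩_HS`**. [cite: Hall2015, Exercise 7.3] -/
theorem hsForm_bracket_self_le (X B : Matrix n n ℂ) :
    hsForm (X * B - B * X) (X * B - B * X) ≤ 4 * (hsForm X X * hsForm B B) := by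
  have h1 := hsForm_sub_self_le (X * B) (B * X)
  have h2 := hsForm_mul_self_le X B
  have h3 := hsForm_mul_self_le B X
  nlinarith [h1, h2, h3]

end HS

/-! ### §2 Skewness of `ad X` and the quantitative Killing bound on `𝔤_r` -/

section Killing

variable {G : Type*} [Group G] [TopologicalSpace G] [CompactSpace G]

/-- **`ad X` is skew for the Hilbert–Schmidt form** on `𝔤_r ≤ 𝔲(N)` (Hall (7.1): the adjoint action of `𝔲(N)` is unitary):
`⟨ad X U, V⟩_HS = −⟨U, ad X V⟩_HS`. [cite: Hall2015, Proposition 7.4] -/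
theorem hsForm_repAd_left (r : LatticeRep G) (X U V : repLieAlgebra r) :
    hsForm ((repAd r X U : repLieAlgebra r) : Matrix (Fin r.N) (Fin r.N) ℂ) (V : Matrix (Fin r.N) (Fin r.N) ℂ) =
      -hsForm (U : Matrix (Fin r.N) (Fin r.N) ℂ) ((repAd r X V : repLieAlgebra r) : Matrix (Fin r.N) (Fin r.N) ℂ) := by
  have hX := conjTranspose_coe_repLieAlgebra r X
  rw [coe_repAd, coe_repAd, hsForm_def, hsForm_def, Matrix.conjTranspose_sub, Matrix.conjTranspose_mul,
    Matrix.conjTranspose_mul, hX, Matrix.sub_mul, Matrix.mul_sub, Matrix.trace_sub, Matrix.trace_sub,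
    Complex.sub_re, Complex.sub_re]
  have h1 : ((U : Matrix (Fin r.N) (Fin r.N) ℂ)ᴴ * -(X : Matrix (Fin r.N) (Fin r.N) ℂ) * V).trace =
      -((U : Matrix (Fin r.N) (Fin r.N) ℂ)ᴴ * ((X : Matrix (Fin r.N) (Fin r.N) ℂ) * V)).trace := by
    rw [Matrix.mul_neg, Matrix.neg_mul, Matrix.trace_neg, Matrix.mul_assoc]
  have h2 : (-(X : Matrix (Fin r.N) (Fin r.N) ℂ) * (U : Matrix (Fin r.N) (Fin r.N) ℂ)ᴴ * V).trace =
      -((U : Matrix (Fin r.N) (Fin r.N) ℂ)ᴴ * (V * (X : Matrix (Fin r.N) (Fin r.N) ℂ))).trace := by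
    rw [Matrix.neg_mul, Matrix.neg_mul, Matrix.trace_neg, Matrix.mul_assoc, Matrix.trace_mul_comm, Matrix.mul_assoc]
  rw [h1, h2, Complex.neg_re, Complex.neg_re]
  ring

/-- **`0 ≤ −K_r(X, X) ≤ 4·dim_ℝ 𝔤_r·⟨X, X⟩_HS`**: in an orthonormal basis `(eₐ)` of `(𝔤_r, ⟨·,·⟩_HS)`,
`−K(X,X) = −Tr(ad X ∘ ad X) = ∑ₐ ‖[X, eₐ]‖²_HS` and each term is `≤ 4‖X‖²‖eₐ‖² = 4‖X‖²`. [cite: Hall2015, Exercise 7.6] -/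
theorem neg_repKilling_self_le (r : LatticeRep G) (X : repLieAlgebra r) :
    -repKilling r X X ≤ 4 * (finrank ℝ (repLieAlgebra r) : ℝ) *
      hsForm (X : Matrix (Fin r.N) (Fin r.N) ℂ) (X : Matrix (Fin r.N) (Fin r.N) ℂ) := by
  classical
  -- the Hilbert–Schmidt inner-product structure on `𝔤_r` (no norm pre-exists on the submodule of `M_N(ℂ)`)
  let cd : InnerProductSpace.Core ℝ (repLieAlgebra r) :=
    { inner := fun U V => hsForm (U : Matrix (Fin r.N) (Fin r.N) ℂ) (V : Matrix (Fin r.N) (Fin r.N) ℂ)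
      conj_inner_symm := fun U V => by simpa using hsForm_comm (V : Matrix (Fin r.N) (Fin r.N) ℂ) U
      re_inner_nonneg := fun U => by simpa using hsForm_self_nonneg (U : Matrix (Fin r.N) (Fin r.N) ℂ)
      add_left := fun U V W => by simp only [Submodule.coe_add, hsForm_add_left]
      smul_left := fun U V c => by simp only [Submodule.coe_smul, hsForm_smul_left, conj_trivial]
      definite := fun U hU => Subtype.ext ((hsForm_self_eq_zero_iff _).1 hU) }
  letI : NormedAddCommGroup (repLieAlgebra r) := @InnerProductSpace.Core.toNormedAddCommGroup ℝ _ _ _ _ cd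
  letI : InnerProductSpace ℝ (repLieAlgebra r) := InnerProductSpace.ofCore _
  have hinner : ∀ U V : repLieAlgebra r,
      ⟪U, V⟫_ℝ = hsForm (U : Matrix (Fin r.N) (Fin r.N) ℂ) (V : Matrix (Fin r.N) (Fin r.N) ℂ) := fun _ _ => rfl
  let b := stdOrthonormalBasis ℝ (repLieAlgebra r)
  -- `K(X,X) = ∑ₐ ⟨eₐ, ad X (ad X eₐ)⟩ = −∑ₐ ⟨ad X eₐ, ad X eₐ⟩`
  have hK : repKilling r X X = -∑ a, hsForm ((repAd r X (b a) : repLieAlgebra r) : Matrix (Fin r.N) (Fin r.N) ℂ)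
      ((repAd r X (b a) : repLieAlgebra r) : Matrix (Fin r.N) (Fin r.N) ℂ) := by
    rw [repKilling_def, LinearMap.trace_eq_sum_inner _ b, ← Finset.sum_neg_distrib]
    refine Finset.sum_congr rfl fun a _ => ?_
    rw [hinner, LinearMap.comp_apply, ← hsForm_repAd_left, hsForm_comm]
  -- each term is at most `4 ⟨X,X⟩ ⟨eₐ,eₐ⟩ = 4 ⟨X,X⟩`
  have hb1 : ∀ a, hsForm ((b a : repLieAlgebra r) : Matrix (Fin r.N) (Fin r.N) ℂ) (b a : Matrix (Fin r.N) (Fin r.N) ℂ) = 1 := by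
    intro a
    rw [← hinner, real_inner_self_eq_norm_sq, b.orthonormal.1 a, one_pow]
  have hterm : ∀ a, hsForm ((repAd r X (b a) : repLieAlgebra r) : Matrix (Fin r.N) (Fin r.N) ℂ)
      ((repAd r X (b a) : repLieAlgebra r) : Matrix (Fin r.N) (Fin r.N) ℂ) ≤
      4 * hsForm (X : Matrix (Fin r.N) (Fin r.N) ℂ) (X : Matrix (Fin r.N) (Fin r.N) ℂ) := by
    intro a
    rw [coe_repAd]
    have h := hsForm_bracket_self_le (X : Matrix (Fin r.N) (Fin r.N) ℂ) (b a : Matrix (Fin r.N) (Fin r.N) ℂ)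
    rwa [hb1 a, mul_one] at h
  rw [hK, neg_neg]
  calc ∑ a, hsForm ((repAd r X (b a) : repLieAlgebra r) : Matrix (Fin r.N) (Fin r.N) ℂ)
        ((repAd r X (b a) : repLieAlgebra r) : Matrix (Fin r.N) (Fin r.N) ℂ)
      ≤ ∑ _a : Fin (finrank ℝ (repLieAlgebra r)), 4 * hsForm (X : Matrix (Fin r.N) (Fin r.N) ℂ) (X : Matrix (Fin r.N) (Fin r.N) ℂ) :=
        Finset.sum_le_sum fun a _ => hterm a
    _ = 4 * (finrank ℝ (repLieAlgebra r) : ℝ) * hsForm (X : Matrix (Fin r.N) (Fin r.N) ℂ) (X : Matrix (Fin r.N) (Fin r.N) ℂ) := by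
        rw [Finset.sum_const, Finset.card_univ, Fintype.card_fin, nsmul_eq_mul]
        ring

/-! ### §3 The Casimir ratio is a genuine supremum; positivity ⇔ non-abelian -/

/-- **`casimirRatioSet r ⊆ [0, 4·dim 𝔤_r]`**. [cite: Hall2015, Exercise 7.6] -/
theorem casimirRatioSet_subset_Icc (r : LatticeRep G) :
    casimirRatioSet r ⊆ Set.Icc 0 (4 * (finrank ℝ (repLieAlgebra r) : ℝ)) := by
  rintro q hq
  refine ⟨casimirRatioSet_nonneg r q hq, ?_⟩
  obtain ⟨X, hX, rfl⟩ := hq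
  rw [div_le_iff₀ (hsForm_self_pos hX)]
  exact neg_repKilling_self_le r X

/-- The quotient set is bounded above. [cite: Hall2015, Exercise 7.6] -/
theorem bddAbove_casimirRatioSet (r : LatticeRep G) : BddAbove (casimirRatioSet r) :=
  ⟨4 * (finrank ℝ (repLieAlgebra r) : ℝ), fun _ hq => (casimirRatioSet_subset_Icc r hq).2⟩

/-- **`λ(G, r) ≤ 4·dim_ℝ 𝔤_r`**. [cite: Hall2015, Exercise 7.6] -/
theorem casimirRatio_le (r : LatticeRep G) : casimirRatio r ≤ 4 * (finrank ℝ (repLieAlgebra r) : ℝ) := by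
  rcases (casimirRatioSet r).eq_empty_or_nonempty with h | h
  · rw [casimirRatio, h, Real.sSup_empty]; positivity
  · exact csSup_le h fun q hq => (casimirRatioSet_subset_Icc r hq).2

/-- Every Rayleigh quotient is below the Casimir ratio: `−K(X,X)/⟨X,X⟩_HS ≤ λ(G, r)` for `0 ≠ X ∈ 𝔤_r`.
[cite: Hall2015, Exercise 7.6] -/
theorem div_le_casimirRatio (r : LatticeRep G) {X : repLieAlgebra r} (hX : (X : Matrix (Fin r.N) (Fin r.N) ℂ) ≠ 0) :
    -repKilling r X X / hsForm (X : Matrix (Fin r.N) (Fin r.N) ℂ) X ≤ casimirRatio r :=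
  le_csSup (bddAbove_casimirRatioSet r) ⟨X, hX, rfl⟩

/-- `−K(X,X) ≤ λ(G, r)·⟨X,X⟩_HS` for every `X ∈ 𝔤_r`. [cite: Hall2015, Exercise 7.6] -/
theorem neg_repKilling_self_le_casimirRatio_mul (r : LatticeRep G) (X : repLieAlgebra r) :
    -repKilling r X X ≤ casimirRatio r * hsForm (X : Matrix (Fin r.N) (Fin r.N) ℂ) X := by
  by_cases hX : (X : Matrix (Fin r.N) (Fin r.N) ℂ) = 0
  · have h0 : X = 0 := Subtype.ext hX
    rw [h0, repKilling_zero_left, neg_zero, Submodule.coe_zero, (hsForm_self_eq_zero_iff _).2 rfl, mul_zero]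
  · rw [← div_le_iff₀ (hsForm_self_pos hX)]
    exact div_le_casimirRatio r hX

/-- **`0 < λ(G, r) ⇔ 𝔤_r` is non-abelian** (some `X, Y ∈ 𝔤_r` do not commute): `K(X,X) = 0` exactly for central `X`
(`repKilling_self_eq_zero_iff`), and a non-zero quotient is positive and below `λ`. [cite: BrockerTomDieck1985, V (5.13)] -/
theorem casimirRatio_pos_iff (r : LatticeRep G) :
    0 < casimirRatio r ↔ ∃ X Y : repLieAlgebra r,
      (X : Matrix (Fin r.N) (Fin r.N) ℂ) * Y ≠ Y * (X : Matrix (Fin r.N) (Fin r.N) ℂ) := by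
  constructor
  · intro hpos
    by_contra hall
    push Not at hall
    -- every `K(X,X) = 0`, so every quotient is `0` and `sSup ≤ 0`
    have hle : casimirRatio r ≤ 0 := by
      rcases (casimirRatioSet r).eq_empty_or_nonempty with h | h
      · rw [casimirRatio, h, Real.sSup_empty]
      · refine csSup_le h ?_
        rintro q ⟨X, hX, rfl⟩
        rw [(repKilling_self_eq_zero_iff r X).2 (hall X), neg_zero, zero_div]
    exact absurd hpos (not_lt.2 hle)
  · rintro ⟨X, Y, hXY⟩
    have hK : repKilling r X X ≠ 0 := fun h => hXY ((repKilling_self_eq_zero_iff r X).1 h Y)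
    have hX : (X : Matrix (Fin r.N) (Fin r.N) ℂ) ≠ 0 := by
      intro h0; apply hXY; rw [h0, Matrix.zero_mul, Matrix.mul_zero]
    have hq : 0 < -repKilling r X X / hsForm (X : Matrix (Fin r.N) (Fin r.N) ℂ) X :=
      div_pos (lt_of_le_of_ne (neg_repKilling_self_nonneg r X) (Ne.symm (neg_ne_zero.2 hK))) (hsForm_self_pos hX)
    exact hq.trans_le (div_le_casimirRatio r hX)

/-- **`λ(G, r) = 0 ⇔ 𝔤_r` is abelian** (e.g. `G = U(1)`: then `b₀(G, r) = 0` — no asymptotic freedom).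
[cite: BrockerTomDieck1985, V (5.13)] -/
theorem casimirRatio_eq_zero_iff (r : LatticeRep G) :
    casimirRatio r = 0 ↔ ∀ X Y : repLieAlgebra r,
      (X : Matrix (Fin r.N) (Fin r.N) ℂ) * Y = Y * (X : Matrix (Fin r.N) (Fin r.N) ℂ) := by
  have h := casimirRatio_pos_iff r
  have h0 := casimirRatio_nonneg r
  constructor
  · intro hz X Y
    by_contra hne
    have : 0 < casimirRatio r := h.2 ⟨X, Y, hne⟩
    linarith
  · intro hall
    by_contra hne
    obtain ⟨X, Y, hXY⟩ := h.1 (lt_of_le_of_ne h0 (Ne.symm hne))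
    exact hXY (hall X Y)

end Killing

end Literature.MathematicalPhysics.QuantumLattice

end
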